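import Mathlib
import HarnessLib

/-!
# Fields with values in a subspace: `(X → U) ≃ Submodule.pi univ U` and the adapted basis `δ_x ⊗ b_s` indexed by `σ × X`
# (Bernstein, *Matrix Mathematics*, Prop. 7.1.6 ∕ Fact 7.4.23: Kronecker bases `e_i ⊗ f_j`)

Topic `Literature/LinearAlgebra`; namespace `Literature.LinearAlgebra.PiSubmodule`.  Two definitions (a linear equivalence and a
basis), the rest proved; no named facts, no `sorry`.

SETTING.  `E` a module over a commutative ring `K`, `U ≤ E` a submodule, `X` a finite index set («sites»).  The `U`-valued
fields on `X` appear in two guises: the product type `X → ↥U` and the submodule `Submodule.pi Set.univ (fun _ : X => U) =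
{Φ : X → E | ∀ x, Φ x ∈ U}` of all `E`-valued fields (the form in which field spaces cut out by a pointwise condition — e.g.
traceless or anti-Hermitian matrix fields — arise).  Given a basis `b : Basis σ K U`, the fields `δ_x · b_s` («site `x`, internal
label `s`») form a basis of the field space indexed by `σ × X` — the index shape of `AdaptedBasisBlockDeterminant.lean` (block label
first).

RESULTS.
* `mem_pi_univ_iff` (`Φ ∈ Submodule.pi univ U ↔ ∀ x, Φ x ∈ U`); def `piConstEquiv U X : (X → ↥U) ≃ₗ[K] ↥(Submodule.pi univ U)`,
  `coe_piConstEquiv`, `coe_piConstEquiv_symm_apply`;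
* ★ def `piAdaptedBasis U b : Basis (σ × X) K ↥(Submodule.pi Set.univ fun _ : X => U)` (= `Pi.basis` mapped and reindexed),
  ★ `coe_piAdaptedBasis` (`(piAdaptedBasis U b (s, x) : X → E) = Pi.single x (b s : E)` — the field supported at `x` with value `b s`),
  `piAdaptedBasis_apply_apply` (pointwise), ★ `piAdaptedBasis_repr` (`repr Φ (s, x) = b.repr (Φ x) s` — coordinates are computed
  site by site), `finrank_pi_univ` (`= #X · rank U` via the basis).

WHY (cell `ym-ir`, row 43, K31).  With `U = ker tr ⊂ M_N(ℂ)` and `b = tracelessPowMulPowBasis` ('t Hooft's colour-momentum basis,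
`QuantumLattice/TwistEaterColourMomentumBasis.lean`) this is the basis `δ_x Γ_p` of the traceless matrix fields in which the complex
covariant Laplacian at a twist eater is block diagonal (blocks = `TwistedCycleLaplacian.twistedTorusLaplacian`), ready for
`AdaptedBasis.det_eq_prod_det`; the consumer's `tracelessFields` is this `Submodule.pi` up to `Iff.rfl` membership.

HONEST SCOPE: elementary linear algebra; nothing here bears on the Yang–Mills mass gap (Clay: NOT proved); `R4` closes only the
conditional finite-`𝕋⁴` rung `BalabanLadder.UV`.

## References
* D. S. Bernstein, *Matrix Mathematics* (2nd ed., 2009), Prop. 7.1.6 (7.1.12) and §7.1 (Kronecker products of coordinate vectors;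
  bases `e_i ⊗ f_j` of `𝔽^{nm}`), held `book:bernstein2009-matrix-mathematics`. [Bernstein2009]
-/

noncomputable section

namespace Literature.LinearAlgebra.PiSubmodule

open Module

variable {K : Type*} [CommRing K] {E : Type*} [AddCommGroup E] [Module K E]
variable (U : Submodule K E) (X : Type*)

/-- Membership in the field space cut out pointwise. [cite: Bernstein2009, §7.1 (coordinate vectors of a product space)] -/
theorem mem_pi_univ_iff (Φ : X → E) : Φ ∈ Submodule.pi Set.univ (fun _ : X => U) ↔ ∀ x, Φ x ∈ U := by
  simp only [Submodule.mem_pi, Set.mem_univ, forall_true_left]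

/-- **`(X → U) ≃ {Φ : X → E | ∀ x, Φ x ∈ U}`**, `K`-linearly (forget ∕ restore the pointwise membership proofs).
[cite: Bernstein2009, §7.1] -/
def piConstEquiv : (X → U) ≃ₗ[K] (Submodule.pi Set.univ (fun _ : X => U)) where
  toFun f := ⟨fun x => (f x : E), fun x _ => (f x).2⟩
  invFun g := fun x => ⟨(g : X → E) x, g.2 x (Set.mem_univ x)⟩
  map_add' _ _ := rfl
  map_smul' _ _ := rfl
  left_inv _ := rfl
  right_inv _ := rfl

/-- Underlying field of `piConstEquiv f`. [cite: Bernstein2009, §7.1] -/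
@[simp] theorem coe_piConstEquiv (f : X → U) :
    ((piConstEquiv U X f : Submodule.pi Set.univ (fun _ : X => U)) : X → E) = fun x => (f x : E) := rfl

/-- Values of `(piConstEquiv)⁻¹ g`. [cite: Bernstein2009, §7.1] -/
@[simp] theorem coe_piConstEquiv_symm_apply (g : Submodule.pi Set.univ (fun _ : X => U)) (x : X) :
    (((piConstEquiv U X).symm g) x : E) = (g : X → E) x := rfl

variable {σ : Type*} [Fintype X] [DecidableEq X]

/-- ★ **The adapted basis `δ_x ⊗ b_s` of the `U`-valued fields, indexed by `σ × X`** (internal label first, site second).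
[cite: Bernstein2009, Prop. 7.1.6 (7.1.12) (Kronecker products of basis vectors)] -/
def piAdaptedBasis (b : Basis σ K U) : Basis (σ × X) K (Submodule.pi Set.univ (fun _ : X => U)) :=
  ((Pi.basis fun _ : X => b).map (piConstEquiv U X)).reindex ((Equiv.sigmaEquivProd X σ).trans (Equiv.prodComm X σ))

variable {U X}

/-- ★ **`piAdaptedBasis U b (s, x)` is the field `δ_x · b_s`**: supported at the site `x` with value `b s`.
[cite: Bernstein2009, Prop. 7.1.6 (7.1.12)] -/
theorem coe_piAdaptedBasis (b : Basis σ K U) (s : σ) (x : X) :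
    ((piAdaptedBasis U X b (s, x) : Submodule.pi Set.univ (fun _ : X => U)) : X → E) = Pi.single x (b s : E) := by
  rw [piAdaptedBasis, Basis.reindex_apply, Basis.map_apply]
  simp only [Equiv.symm_trans_apply, Equiv.prodComm_symm, Equiv.prodComm_apply, Prod.swap_prod_mk,
    Equiv.sigmaEquivProd_symm_apply, Pi.basis_apply, coe_piConstEquiv]
  funext y
  by_cases h : y = x
  · subst h; simp
  · simp [h]

/-- Pointwise: `(δ_x · b_s)(y) = if y = x then b s else 0`. [cite: Bernstein2009, Prop. 7.1.6 (7.1.12)] -/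
theorem piAdaptedBasis_apply_apply (b : Basis σ K U) (s : σ) (x y : X) :
    ((piAdaptedBasis U X b (s, x) : Submodule.pi Set.univ (fun _ : X => U)) : X → E) y = if y = x then (b s : E) else 0 := by
  rw [coe_piAdaptedBasis, Pi.single_apply]

omit [DecidableEq X] in
/-- ★ **Coordinates are computed site by site**: `repr Φ (s, x) = b.repr ⟨Φ x, _⟩ s`. [cite: Bernstein2009, Prop. 7.1.6 (7.1.12)] -/
theorem piAdaptedBasis_repr (b : Basis σ K U) (Φ : Submodule.pi Set.univ (fun _ : X => U)) (s : σ) (x : X) :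
    (piAdaptedBasis U X b).repr Φ (s, x) = b.repr ⟨(Φ : X → E) x, Φ.2 x (Set.mem_univ x)⟩ s := by
  rw [piAdaptedBasis, Basis.repr_reindex_apply]
  rfl

omit [DecidableEq X] in
/-- `rank {Φ : X → E | ∀ x, Φ x ∈ U} = #σ · #X` for a basis `b : Basis σ K U` (`K` a field or any ring with invariant basis
number). [cite: Bernstein2009, §7.1] -/
theorem finrank_pi_univ [StrongRankCondition K] [Fintype σ] (b : Basis σ K U) :
    Module.finrank K (Submodule.pi Set.univ (fun _ : X => U)) = Fintype.card σ * Fintype.card X := by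
  classical
  rw [Module.finrank_eq_card_basis (piAdaptedBasis U X b), Fintype.card_prod]

end Literature.LinearAlgebra.PiSubmodule

end
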